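import Summits.BirchSwinnertonDyer.BirchSwinnertonDyer.Theses.QuadraticBranchSignedControl
import Summits.BirchSwinnertonDyer.BirchSwinnertonDyer.Theses.InertBadSignedBranches
import Summits.BirchSwinnertonDyer.Rank1Residual.Additive.QuadraticBranchEvenLocalControl
import HarnessLib

/-!
# QuadraticBranchSignedControl — BC3 BIRTH SKELETON v2 (planner bsd-potss-plan g7/g8; stub statements keyed as `Sig.stub_<name>` so the `_of` hypotheses are the declared stubs BY NAME): per-crux stubs + proved `_of` recomposition concluding the ROUTE decl by name

Thesis X: on the quadratic branch Gss2 (`W/ℚ` additive at an odd `p` with `W^{(p*)}` good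
supersingular, `a_p = 0`, `p ≥ 5`) Kobayashi's EVEN main conjecture on the `η`-branch (C1_η),
transported to `W` through the `η`-twist Selmer dictionary (both signs), Kitajima–Otsuki's
no-finite-submodule property, the `p`-adic Gross–Zagier valuation law on the minus branch (rank 1)
and B. D. Kim's exact control with Tamagawa defect (rank 0) give `ord_p #Ш = ord_p #Ш_an` on every
Gss2 pair `p ≥ 5`; the `p = 3` share is a declared residual. `closes` targets the rung leaf
`Summit.BirchSwinnertonDyer.Rank1Residual.Additive.O5SharpGss` (D-0061 ALT-CLOSER, rung K8).
Every crux is the ∀-closure over the cell of an EXISTING typed `@[conjecture] def` node.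

ADDENDUM (prover leafhand-bsd-inertbadsignedbran-1-g0, 2026-08-30): everything above `PlusMainConjectureBranch_inert_of` is the
registered birth skeleton e1351564ffc5a131 VERBATIM (plus one `import`).  The item is wanted by BOTH routes
`QuadraticBranchSignedControl` (crux, rank 2) and `InertBadSignedBranches` (aside, rank 9), whose route files declare
`PlusMainConjectureBranch` with IDENTICAL bodies (`∀ V p, 5 ≤ p → good → a_p = 0 → Additive.QuadraticBranchPlusMainConjectureAt V p`);
the two added theorems conclude the `InertBadSignedBranches` copy BY NAME from the same two branch-field stubs (definitional
unfolding, no new content), so one registered skeleton serves both wanting routes.  Stub names / `Sig.` statements unchanged;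
`lean check`: rc 0, sorries 3 (= the three stubs).
-/

noncomputable section

open scoped Classical MatrixGroups ModularForm

open CongruenceSubgroup Field Function NumberField IsDedekindDomain WeierstrassCurve
open Literature.NumberTheory.EllipticCurves
open Literature.NumberTheory.EllipticCurves.ModularForms
open Literature.NumberTheory.EllipticCurves.Kobayashi2003
open Literature.NumberTheory.EllipticCurves.Rank1Residual
open Literature.NumberTheory.EllipticCurves.Rank1Residual.Typed
open Literature.NumberTheory.GaloisRepresentations
open Literature.NumberTheory.GaloisCohomology
open Literature.NumberTheory.EllipticCurves.IwasawaAlgebra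
open Summit.BirchSwinnertonDyer.Rank1Residual Summit.BirchSwinnertonDyer.Rank1Residual.Additive
open Summit.BirchSwinnertonDyer.BirchSwinnertonDyer.Theses.QuadraticBranchSignedControl

namespace Summit.BirchSwinnertonDyer.BirchSwinnertonDyer.Cruxes.PlusMainConjectureBranch.Birth

/-! ### C1 `PlusMainConjectureBranch` — split by the branch field: `F = ℚ(√p)` real (`p ≡ 1 mod 4`)
vs `F = ℚ(√-p)` imaginary (`p ≡ 3 mod 4`); BC5 rung = the CM rows (Rubin's two-variable main
conjecture + Pollack–Rubin). -/
/-- Statement of `stub_plusMC_real` (keyed by the registered stub name): the plus main conjecture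
on the REAL branch field `ℚ(√p)`, `p ≡ 1 (mod 4)`. -/
abbrev Sig.stub_plusMC_real : Prop :=
  ∀ (V : WeierstrassCurve ℚ) [V.IsElliptic] [V.IsGloballyMinimal] (p : ℕ) [Fact p.Prime],
    5 ≤ p → p % 4 = 1 → V.HasGoodReductionAtPrime p → V.frobeniusTrace p = 0 →
      QuadraticBranchPlusMainConjectureAt V p

/-- Statement of `stub_plusMC_imaginary`: the plus main conjecture on the IMAGINARY branch field
`ℚ(√-p)`, `p ≡ 3 (mod 4)`. -/
abbrev Sig.stub_plusMC_imaginary : Prop :=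
  ∀ (V : WeierstrassCurve ℚ) [V.IsElliptic] [V.IsGloballyMinimal] (p : ℕ) [Fact p.Prime],
    5 ≤ p → p % 4 = 3 → V.HasGoodReductionAtPrime p → V.frobeniusTrace p = 0 →
      QuadraticBranchPlusMainConjectureAt V p

/-- Statement of the BC5 plan-only rung `stub_plusMC_CM_rung`: the CM rows (`V` with complex
multiplication, `p ≥ 5` inert in the CM field so that `a_p = 0`), via Rubin 1991 (two-variable MC
over the CM field) + Pollack–Rubin 2004.  A special case of the crux, not a hypothesis of `_of`. -/
abbrev Sig.stub_plusMC_CM_rung : Prop :=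
  ∀ (V : WeierstrassCurve ℚ) [V.IsElliptic] [V.IsGloballyMinimal] (p : ℕ) [Fact p.Prime],
    5 ≤ p → V.HasCM → V.HasGoodReductionAtPrime p → V.frobeniusTrace p = 0 →
      QuadraticBranchPlusMainConjectureAt V p

theorem stub_plusMC_real : Sig.stub_plusMC_real := by
  sorry

theorem stub_plusMC_imaginary : Sig.stub_plusMC_imaginary := by
  sorry

theorem stub_plusMC_CM_rung : Sig.stub_plusMC_CM_rung := by
  sorry

/-- Composition: the two branch-field stubs give the crux BY NAME (an odd prime is `1` or `3 mod 4`). -/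
theorem PlusMainConjectureBranch_of (hre : Sig.stub_plusMC_real) (him : Sig.stub_plusMC_imaginary) :
    PlusMainConjectureBranch := by
  intro V _ _ p hp hp5 hgood hap
  have h2 : ¬ 2 ∣ p := fun h =>
    absurd ((Nat.Prime.eq_one_or_self_of_dvd hp.out 2 h).resolve_left (by norm_num)) (by omega)
  have h4 : p % 4 = 1 ∨ p % 4 = 3 := by omega
  rcases h4 with h | h
  · exact hre V p hp5 h hgood hap
  · exact him V p hp5 h hgood hap

/-- The crux from the (sorried) stubs — records that the stub set is complete. -/
theorem plusMainConjectureBranch_of_stubs : PlusMainConjectureBranch :=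
  PlusMainConjectureBranch_of stub_plusMC_real stub_plusMC_imaginary

/-- The rung is a special case of the crux (sanity: the rung lies INSIDE the crux). -/
theorem plusMC_CM_rung_of_crux (h : PlusMainConjectureBranch) : Sig.stub_plusMC_CM_rung :=
  fun V _ _ p _ hp5 _ hgood hap => h V p hp5 hgood hap

/-- Composition for the SECOND wanting route: the two branch-field stubs give the `InertBadSignedBranches` copy of the
crux BY NAME (same body; definitional unfolding). -/
theorem PlusMainConjectureBranch_inert_of (hre : Sig.stub_plusMC_real) (him : Sig.stub_plusMC_imaginary) :
    Summit.BirchSwinnertonDyer.BirchSwinnertonDyer.Theses.InertBadSignedBranches.PlusMainConjectureBranch :=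
  fun V _ _ p _ => PlusMainConjectureBranch_of hre him V p

/-- The `InertBadSignedBranches` copy of the crux from the (sorried) stubs — records that the stub set is complete for
that route too. -/
theorem plusMainConjectureBranch_inert_of_stubs :
    Summit.BirchSwinnertonDyer.BirchSwinnertonDyer.Theses.InertBadSignedBranches.PlusMainConjectureBranch :=
  PlusMainConjectureBranch_inert_of stub_plusMC_real stub_plusMC_imaginary

end Summit.BirchSwinnertonDyer.BirchSwinnertonDyer.Cruxes.PlusMainConjectureBranch.Birth
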